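import Mathlib
import Summits.Ventures.PercRepro2.Defs
import Summits.Ventures.PercRepro2.Independence
import Summits.Ventures.PercRepro2.Harris
import Summits.Ventures.PercRepro2.Graph
import Summits.Ventures.PercRepro2.Exploration
import Summits.Ventures.PercRepro2.Events
import Summits.Ventures.PercRepro2.FourFunctions
import Summits.Ventures.PercRepro2.Induced
import Summits.Ventures.PercRepro2.Frontier
import Summits.Ventures.PercRepro2.ObsIndependence
import Summits.Ventures.PercRepro2.BHK
import Summits.Ventures.PercRepro2.BHKEvents
import Summits.Ventures.PercRepro2.MultiSource
import Summits.Ventures.PercRepro2.OrderPreservation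
import Summits.Ventures.PercRepro2.SeedSet
import Summits.Ventures.PercRepro2.MultiSourceFun
import Summits.Ventures.PercRepro2.CrossRootT
import Summits.Ventures.PercRepro2.VdBKahn
import Summits.Ventures.PercRepro2.HullDefs
import Summits.Ventures.PercRepro2.CCTRootEdge
import Summits.Ventures.PercRepro2.PASubDefs
import Summits.Ventures.PercRepro2.HalfN

/-!
# Lemma N: the N-class of the T-frame (blind cell PercRepro2, typer-1; mine-c g3
`proofs/MINEC-THEOREMS.md` Lemma N, INBOX 2026-08-23T11:03:51Z)

With `K⁻ = C_{ω⁻}(T)` (e-closed seed cluster), `lam(W) = P(K⁻ = W)`, `x₀(W) = P(X_W)` (`Xdel`), the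
`N`-class `{u, w ∉ K⁻}` of an edge `e = {u, w}` and the masses `S = Σ_{W ∌ s} lam`, `N = Σ_{W ∌ s,u,w} lam`:

**`lemmaN`** (cleared by `S²`): `0 ≤ S² · Σ_N x₀ y₀ lam − S · (Σ_S x₀ lam)(Σ_N y₀ lam) − S · (Σ_S y₀ lam)(Σ_N x₀ lam)
+ (Σ_S x₀ lam)(Σ_S y₀ lam) · N`, i.e. `E_{μ₀}[(X − m⁰_X)(Y − m⁰_Y); u, w ∉ K⁻] ≥ 0` (the `XY`-term
already bounded below by `x₀ y₀` termwise via Harris, see `paSub`): `Cov` over the `{s,u,w}`-avoiding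
seed-set law is `≥ 0` (`bhk_multi` with `1 − x₀`, `1 − y₀` and the avoided set `{s, u, w}`), and the
restricted means dominate the unrestricted ones (`bhk_multi` with `F₂ = 1` and the avoided sets
`{s, u, w}`, `{s}` — the monotonicity of BHK 1.3 in the avoided set for the increasing `1 − x₀`).
-/

namespace Summit.Ventures.PercRepro2

namespace LemmaN

open PASub HalfN

open scoped Classical

variable {V : Type*} {E : Type*} [Fintype E] [DecidableEq E] [Fintype V] [DecidableEq V]
  {R : Type*} [Field R] [LinearOrder R] [IsStrictOrderedRing R]

section Law

variable (p : E → R) (ends : E → Sym2 V) (e : E) (T : Finset V)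

omit [Fintype E] [DecidableEq V] [Fintype V] in
/-- `ω⁻` avoids `X` as a seed set iff `K⁻` misses `X`. -/
lemma update_false_mem_avoidAllT_iff' (X : Finset V) (ω : Config E) :
    Function.update ω e false ∈ avoidAllT ends T X ↔ ∀ x ∈ X, x ∉ KsetM ends e T ω := by
  simp only [avoidAllT, Set.mem_setOf_eq, KsetM, mem_clusterSet, not_exists, not_and]
  exact ⟨fun h x hx t ht => h t ht x hx, fun h t ht x hx => h x hx t ht⟩

omit [LinearOrder R] [IsStrictOrderedRing R] in
/-- Transfer of the `e`-closed seed-set law with a general avoided set: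
`E_{p[e↦0]}[f(C(T)) · 1_{T ↮ X}] = Σ_W [W ∩ X = ∅] f(W) P(K⁻ = W)`. -/
lemma expect_update_zero_KX (X : Finset V) (f : Set V → R) :
    expect (Function.update p e 0)
        (fun ω => f (clusterSet ends ω T) * (avoidAllT ends T X).indicator 1 ω) =
      ∑ W : Set V, if (∀ x ∈ X, x ∉ W) then f W * prob p (KEventM ends e T W) else 0 := by
  rw [expect_update_zero]
  unfold expect prob
  have hmove : ∀ W : Set V,
      (if (∀ x ∈ X, x ∉ W) then f W * ∑ ω, (KEventM ends e T W).indicator (weight p) ω else 0) =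
        ∑ ω, if (∀ x ∈ X, x ∉ W) then f W * (KEventM ends e T W).indicator (weight p) ω else 0 := by
    intro W
    split_ifs <;> simp [Finset.mul_sum]
  simp_rw [hmove]
  rw [Finset.sum_comm]
  refine Finset.sum_congr rfl fun ω _ => ?_
  rw [Finset.sum_eq_single (KsetM ends e T ω)]
  · by_cases hs : ∀ x ∈ X, x ∉ KsetM ends e T ω
    · have h1 : ω ∈ KEventM ends e T (KsetM ends e T ω) := rfl
      rw [if_pos hs, Set.indicator_of_mem h1,
        Set.indicator_of_mem ((update_false_mem_avoidAllT_iff' ends e T X ω).2 hs)]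
      simp only [KsetM, Pi.one_apply, mul_one]
      ring
    · rw [if_neg hs, Set.indicator_of_notMem
        (fun h => hs ((update_false_mem_avoidAllT_iff' ends e T X ω).1 h))]
      simp
  · intro W _ hW
    by_cases hs : ∀ x ∈ X, x ∉ W
    · have h2 : ω ∉ KEventM ends e T W := fun h => hW h.symm
      rw [if_pos hs, Set.indicator_of_notMem h2]
      simp
    · rw [if_neg hs]
  · intro h
    exact absurd (Finset.mem_univ _) h

end Law

section Sums

variable (p : E → R) (ends : E → Sym2 V) (e : E) (T : Finset V)

/-- `Σ_{W ∩ X = ∅} f(W) · P(K⁻ = W)`: the `X`-avoiding part of the `e`-closed seed-set law. -/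
noncomputable def sumX (X : Finset V) (f : Set V → R) : R :=
  ∑ W : Set V, if (∀ v ∈ X, v ∉ W) then f W * prob p (KEventM ends e T W) else 0

omit [LinearOrder R] [IsStrictOrderedRing R] in
/-- `expect_update_zero_KX` in the `sumX` notation. -/
lemma expect_update_zero_eq_sumX (X : Finset V) (f : Set V → R) :
    expect (Function.update p e 0)
        (fun ω => f (clusterSet ends ω T) * (avoidAllT ends T X).indicator 1 ω) =
      sumX p ends e T X f :=
  expect_update_zero_KX p ends e T X f

omit [LinearOrder R] [IsStrictOrderedRing R] in
/-- The mass of the `X`-avoiding law. -/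
lemma prob_avoidAllT_eq_sumX (X : Finset V) :
    prob (Function.update p e 0) (avoidAllT ends T X) = sumX p ends e T X (fun _ => 1) := by
  rw [← expect_update_zero_eq_sumX, prob_eq_expect_indicator]
  simp only [one_mul]

omit [LinearOrder R] [IsStrictOrderedRing R] in
/-- `sumX` of `1 − f`. -/
lemma sumX_one_sub (X : Finset V) (f : Set V → R) :
    sumX p ends e T X (fun W => 1 - f W) = sumX p ends e T X (fun _ => 1) - sumX p ends e T X f := by
  unfold sumX
  rw [← Finset.sum_sub_distrib]
  refine Finset.sum_congr rfl fun W _ => ?_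
  split_ifs <;> ring

omit [LinearOrder R] [IsStrictOrderedRing R] in
/-- `sumX` of `(1 − f)(1 − g)`. -/
lemma sumX_one_sub_mul (X : Finset V) (f g : Set V → R) :
    sumX p ends e T X ((fun W => 1 - f W) * fun W => 1 - g W) =
      sumX p ends e T X (fun _ => 1) - sumX p ends e T X f - sumX p ends e T X g +
        sumX p ends e T X (fun W => f W * g W) := by
  unfold sumX
  rw [← Finset.sum_sub_distrib, ← Finset.sum_sub_distrib, ← Finset.sum_add_distrib]
  refine Finset.sum_congr rfl fun W _ => ?_
  simp only [Pi.mul_apply]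
  split_ifs <;> ring

omit [LinearOrder R] [IsStrictOrderedRing R] in
/-- `sumX` of `f · 1`. -/
lemma sumX_mul_one (X : Finset V) (f : Set V → R) :
    sumX p ends e T X (f * fun _ => 1) = sumX p ends e T X f := by
  unfold sumX
  refine Finset.sum_congr rfl fun W _ => ?_
  simp only [Pi.mul_apply, mul_one]

/-- `sumX` is monotone in `f`. -/
lemma sumX_mono (hp : IsProbVec p) (X : Finset V) {f g : Set V → R} (h : ∀ W, f W ≤ g W) :
    sumX p ends e T X f ≤ sumX p ends e T X g := by
  unfold sumX
  refine Finset.sum_le_sum fun W _ => ?_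
  split_ifs
  · exact mul_le_mul_of_nonneg_right (h W) (prob_nonneg hp _)
  · exact le_refl _

/-- `sumX` of a nonnegative `f` is nonnegative. -/
lemma sumX_nonneg (hp : IsProbVec p) (X : Finset V) {f : Set V → R} (h : ∀ W, 0 ≤ f W) :
    0 ≤ sumX p ends e T X f := by
  unfold sumX
  refine Finset.sum_nonneg fun W _ => ?_
  split_ifs
  · exact mul_nonneg (h W) (prob_nonneg hp _)
  · exact le_refl _

end Sums

section Main

variable (p : E → R) (ends : E → Sym2 V) (e : E) (s : V) (T : Finset V)

/-- **Lemma N** (mine-c), cleared by `S²`: with `x(W) = P(X_W)`, `y(W) = P(Y_W)`, `S = Σ_{W ∌ s} λ`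
(`sumX {s} 1`), `N = Σ_{W ∌ s,u,w} λ` (`sumX {s,u,w} 1`),
`0 ≤ S² Σ_N x y λ − S (Σ_S x λ)(Σ_N y λ) − S (Σ_S y λ)(Σ_N x λ) + (Σ_S x λ)(Σ_S y λ) N`,
i.e. `E_{μ₀}[(X − m⁰_X)(Y − m⁰_Y); u, w ∉ K⁻] ≥ 0` modulo the termwise Harris bound `E[XY ∣ K = W] ≥ x y`. -/
theorem lemmaN (hp : IsProbVec p) (u w a b : V) :
    0 ≤ sumX p ends e T {s} (fun _ => 1) ^ 2 *
          sumX p ends e T {s, u, w} (fun W => prob p (Xdel ends e s W a) * prob p (Xdel ends e s W b)) -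
        sumX p ends e T {s} (fun _ => 1) *
          (sumX p ends e T {s} (fun W => prob p (Xdel ends e s W a)) *
            sumX p ends e T {s, u, w} (fun W => prob p (Xdel ends e s W b))) -
        sumX p ends e T {s} (fun _ => 1) *
          (sumX p ends e T {s} (fun W => prob p (Xdel ends e s W b)) *
            sumX p ends e T {s, u, w} (fun W => prob p (Xdel ends e s W a))) +
        sumX p ends e T {s} (fun W => prob p (Xdel ends e s W a)) *
          sumX p ends e T {s} (fun W => prob p (Xdel ends e s W b)) *
          sumX p ends e T {s, u, w} (fun _ => 1) := by
  have hp₀ : IsProbVec (Function.update p e 0) := hp.update e le_rfl zero_le_one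
  have hx_anti : ∀ {W W' : Set V}, W ⊆ W' →
      prob p (Xdel ends e s W' a) ≤ prob p (Xdel ends e s W a) :=
    fun h => prob_mono hp (Xdel_anti ends e s h a)
  have hy_anti : ∀ {W W' : Set V}, W ⊆ W' →
      prob p (Xdel ends e s W' b) ≤ prob p (Xdel ends e s W b) :=
    fun h => prob_mono hp (Xdel_anti ends e s h b)
  have hmx : Monotone (fun W => 1 - prob p (Xdel ends e s W a)) :=
    fun W W' h => by simp only; linarith [hx_anti h]
  have hmy : Monotone (fun W => 1 - prob p (Xdel ends e s W b)) :=
    fun W W' h => by simp only; linarith [hy_anti h]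
  have hnx : ∀ W, 0 ≤ 1 - prob p (Xdel ends e s W a) := fun W => sub_nonneg.2 (prob_le_one hp _)
  have hny : ∀ W, 0 ≤ 1 - prob p (Xdel ends e s W b) := fun W => sub_nonneg.2 (prob_le_one hp _)
  have hone : Monotone (fun _ : Set V => (1 : R)) := fun _ _ _ => le_refl _
  have hone0 : ∀ _ : Set V, (0 : R) ≤ 1 := fun _ => zero_le_one
  have hinter : ({s, u, w} : Finset V) ∩ {s} = {s} := by
    ext v; simp only [Finset.mem_inter, Finset.mem_insert, Finset.mem_singleton]; tauto
  have hunion : ({s, u, w} : Finset V) ∪ {s} = {s, u, w} := by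
    ext v; simp only [Finset.mem_union, Finset.mem_insert, Finset.mem_singleton]; tauto
  -- (a) the covariance under the `{s,u,w}`-avoiding law
  have keyN := bhk_multi (Function.update p e 0) hp₀ ends T hmx hmy hnx hny {s, u, w} {s, u, w}
  rw [Finset.inter_self, Finset.union_self,
    expect_update_zero_eq_sumX p ends e T _ (fun W => 1 - prob p (Xdel ends e s W a)),
    expect_update_zero_eq_sumX p ends e T _ (fun W => 1 - prob p (Xdel ends e s W b)),
    expect_update_zero_eq_sumX p ends e T _
      ((fun W => 1 - prob p (Xdel ends e s W a)) * fun W => 1 - prob p (Xdel ends e s W b)),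
    prob_avoidAllT_eq_sumX, sumX_one_sub, sumX_one_sub, sumX_one_sub_mul] at keyN
  -- (b) the shifts: `bhk_multi` with `F₂ = 1`, avoided sets `{s,u,w}` and `{s}`
  have keyX := bhk_multi (Function.update p e 0) hp₀ ends T hmx hone hnx hone0 {s, u, w} {s}
  rw [hinter, hunion,
    expect_update_zero_eq_sumX p ends e T _ (fun W => 1 - prob p (Xdel ends e s W a)),
    expect_update_zero_eq_sumX p ends e T _ (fun _ => (1 : R)),
    expect_update_zero_eq_sumX p ends e T _
      ((fun W => 1 - prob p (Xdel ends e s W a)) * fun _ => (1 : R)),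
    prob_avoidAllT_eq_sumX, sumX_mul_one, sumX_one_sub, sumX_one_sub] at keyX
  have keyY := bhk_multi (Function.update p e 0) hp₀ ends T hmy hone hny hone0 {s, u, w} {s}
  rw [hinter, hunion,
    expect_update_zero_eq_sumX p ends e T _ (fun W => 1 - prob p (Xdel ends e s W b)),
    expect_update_zero_eq_sumX p ends e T _ (fun _ => (1 : R)),
    expect_update_zero_eq_sumX p ends e T _
      ((fun W => 1 - prob p (Xdel ends e s W b)) * fun _ => (1 : R)),
    prob_avoidAllT_eq_sumX, sumX_mul_one, sumX_one_sub, sumX_one_sub] at keyY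
  -- bounds `0 ≤ Nx, Ny, Nxy ≤ N`
  have hNx0 : 0 ≤ sumX p ends e T {s, u, w} (fun W => prob p (Xdel ends e s W a)) :=
    sumX_nonneg p ends e T hp _ fun W => prob_nonneg hp _
  have hNy0 : 0 ≤ sumX p ends e T {s, u, w} (fun W => prob p (Xdel ends e s W b)) :=
    sumX_nonneg p ends e T hp _ fun W => prob_nonneg hp _
  have hNxy0 : 0 ≤ sumX p ends e T {s, u, w}
      (fun W => prob p (Xdel ends e s W a) * prob p (Xdel ends e s W b)) :=
    sumX_nonneg p ends e T hp _ fun W => mul_nonneg (prob_nonneg hp _) (prob_nonneg hp _)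
  have hNx1 : sumX p ends e T {s, u, w} (fun W => prob p (Xdel ends e s W a)) ≤
      sumX p ends e T {s, u, w} (fun _ => 1) :=
    sumX_mono p ends e T hp _ fun W => prob_le_one hp _
  have hNy1 : sumX p ends e T {s, u, w} (fun W => prob p (Xdel ends e s W b)) ≤
      sumX p ends e T {s, u, w} (fun _ => 1) :=
    sumX_mono p ends e T hp _ fun W => prob_le_one hp _
  have hNxy1 : sumX p ends e T {s, u, w}
      (fun W => prob p (Xdel ends e s W a) * prob p (Xdel ends e s W b)) ≤
      sumX p ends e T {s, u, w} (fun _ => 1) :=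
    sumX_mono p ends e T hp _ fun W =>
      mul_le_one₀ (prob_le_one hp _) (prob_nonneg hp _) (prob_le_one hp _)
  have hN0 : 0 ≤ sumX p ends e T {s, u, w} (fun _ => (1 : R)) :=
    sumX_nonneg p ends e T hp _ fun _ => zero_le_one
  -- abbreviations (atoms)
  generalize sumX p ends e T {s} (fun _ => (1 : R)) = S at *
  generalize sumX p ends e T {s, u, w} (fun _ => (1 : R)) = N at *
  generalize sumX p ends e T {s} (fun W => prob p (Xdel ends e s W a)) = Sx at *
  generalize sumX p ends e T {s} (fun W => prob p (Xdel ends e s W b)) = Sy at *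
  generalize sumX p ends e T {s, u, w} (fun W => prob p (Xdel ends e s W a)) = Nx at *
  generalize sumX p ends e T {s, u, w} (fun W => prob p (Xdel ends e s W b)) = Ny at *
  generalize sumX p ends e T {s, u, w}
    (fun W => prob p (Xdel ends e s W a) * prob p (Xdel ends e s W b)) = Nxy at *
  have h1 : Nx * Ny ≤ N * Nxy := by nlinarith [keyN]
  have h2 : Sx * N ≤ S * Nx := by nlinarith [keyX]
  have h3 : Sy * N ≤ S * Ny := by nlinarith [keyY]
  rcases hN0.lt_or_eq with hpos | hzero
  · have hid : N * (S ^ 2 * Nxy - S * (Sx * Ny) - S * (Sy * Nx) + Sx * Sy * N) =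
        S ^ 2 * (N * Nxy - Nx * Ny) + (S * Nx - Sx * N) * (S * Ny - Sy * N) := by ring
    have hA : 0 ≤ S ^ 2 * (N * Nxy - Nx * Ny) := mul_nonneg (sq_nonneg _) (by linarith)
    have hB : 0 ≤ (S * Nx - Sx * N) * (S * Ny - Sy * N) :=
      mul_nonneg (by linarith) (by linarith)
    have : 0 ≤ N * (S ^ 2 * Nxy - S * (Sx * Ny) - S * (Sy * Nx) + Sx * Sy * N) := by
      rw [hid]; linarith
    exact (mul_nonneg_iff_of_pos_left hpos).1 this
  · have hNxz : Nx = 0 := le_antisymm (hzero ▸ hNx1) hNx0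
    have hNyz : Ny = 0 := le_antisymm (hzero ▸ hNy1) hNy0
    have hNxyz : Nxy = 0 := le_antisymm (hzero ▸ hNxy1) hNxy0
    rw [hNxz, hNyz, hNxyz, ← hzero]
    ring_nf
    exact le_refl _

end Main

end LemmaN

end Summit.Ventures.PercRepro2
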